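import Summits.ValiantsHypothesis.ValiantsHypothesis.Theorems.BarrierLeverPartitionMinorsChowDoubleStep
import Summits.ValiantsHypothesis.ValiantsHypothesis.Theorems.BarrierLeverPartitionMinorsChowEdgeCoreEngine

/-!
# Route BarrierLever — Chow witnesses for partition minors (item 20172, CPM): the DOUBLE-CORE ENGINE
# (locked ∧ unpeelable ∧ no leaf step ∧ no edge step ∧ no double step)

Helper file (`--supports stmt-ValiantsHypothesis-20172`; cell valiant-natproofs, rung V4, 𝒟-side of
door (c); seat val-np-p4 gen 13).  Closes NO item.  Conventions of items 19717 / 20172 / 20195: a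
layout `(u, w)` of height `h` is HIT when some product of `h + h` affine forms has nonsingular
partition minor `det[coeff_{E (u i) (w j)} ∏ ℓ]`.

`chow_hit_of_doubleCore` — the edge-core engine (`chow_hit_of_edgeCore`) sharpened by the `k = 2`
star double step (`chow_doubleStep`): **a minimal layout missed by all products of `h + h` affine
forms is injective, locked, unpeelable, of size `r ≥ h + 1`, admits no leaf step, no edge step, AND
no double step on either side**, where a DOUBLE STEP on the row side consists of two row coordinates
`a ≠ a'`, a base row `i₀` and two special rows `v₁, v₂` with the `{a,a'}`-erased label of `i₀`, `v₁`
differing from `i₀` exactly in the `a`-status and `v₂` exactly in the `a'`-status, the `{a,a'}`-erasure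
injective on the other rows; and two column coordinates `c ≠ c'` with excess columns `j₁, j₂`
colliding with `j₀, j₀'` under the `{c,c'}`-erasure, nonsingular status-difference matrix, and the
`{c,c'}`-erasure injective off `j₁, j₂`.

`erase₂_eq_of_preimage₂_eq`, `preimage₂_injective_of_injOn` — the double pull-back determines the
doubly erased label (injectivity transfer for the reduced layouts); `doubleStep_of_data` — the
double step from the engine's succAbove-free data.

Census (kit j282264, exact): at `(h, r) = (5, 6)` the double step applies to `114 240` of the
`351 840` star-row cores that survive the leaf/edge engine; the residue of record is described in
the seat memo HOME/val-np-p4/g13 §4.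

WHAT THIS IS NOT: an organising principle (reduction), not a hit; nothing on items 20172 / 20195 /
19717 themselves, on crux stmt-ValiantsHypothesis-14610, or on `VP` versus `VNP`.
-/

set_option linter.dupNamespace false

namespace Summit.ValiantsHypothesis.ValiantsHypothesis.Theorems.BarrierLever.ChowFactor

open Finset MvPolynomial

noncomputable section

/-! ## 1. The double pull-back determines the doubly erased label -/

/-- Equal double pull-backs along `a.succAbove`, `b.succAbove` have equal `{a, a.succAbove b}`-erased
labels. -/
theorem erase₂_eq_of_preimage₂_eq {h : ℕ} (a : Fin (h + 2)) (b : Fin (h + 1)) {S T : Finset (Fin (h + 2))}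
    (he : ((S.preimage a.succAbove Fin.succAbove_right_injective.injOn).preimage b.succAbove
        Fin.succAbove_right_injective.injOn) =
      ((T.preimage a.succAbove Fin.succAbove_right_injective.injOn).preimage b.succAbove
        Fin.succAbove_right_injective.injOn)) :
    (S.erase a).erase (a.succAbove b) = (T.erase a).erase (a.succAbove b) := by
  classical
  have key : ∀ U : Finset (Fin (h + 2)), (U.erase a).erase (a.succAbove b) =
      ((((U.preimage a.succAbove Fin.succAbove_right_injective.injOn).preimage b.succAbove
        Fin.succAbove_right_injective.injOn).map (Fin.succAboveEmb b)).map (Fin.succAboveEmb a)) := by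
    intro U
    rw [erase_eq_map_preimage_succAbove a U, ← erase_eq_map_preimage_succAbove b, Finset.map_erase]
    rfl
  rw [key S, key T, he]

/-- Injectivity of the doubly reduced family from injectivity of the doubly erased labels. -/
theorem preimage₂_injective_of_injOn {h r : ℕ} (a : Fin (h + 2)) (b : Fin (h + 1))
    (u : Fin (r + 2) → Finset (Fin (h + 2))) (v₁ : Fin (r + 2)) (v₂'' : Fin (r + 1))
    (hinj : Set.InjOn (fun i => ((u i).erase a).erase (a.succAbove b))
      {i | i ≠ v₁ ∧ i ≠ v₁.succAbove v₂''}) :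
    Function.Injective fun k : Fin r =>
      ((u (v₁.succAbove (v₂''.succAbove k))).preimage a.succAbove
        Fin.succAbove_right_injective.injOn).preimage b.succAbove Fin.succAbove_right_injective.injOn := by
  intro k k' hkk
  have he := erase₂_eq_of_preimage₂_eq a b hkk
  have hk : v₁.succAbove (v₂''.succAbove k) ∈ {i | i ≠ v₁ ∧ i ≠ v₁.succAbove v₂''} :=
    ⟨Fin.succAbove_ne v₁ _, fun e => Fin.succAbove_ne v₂'' k (Fin.succAbove_right_injective e)⟩
  have hk' : v₁.succAbove (v₂''.succAbove k') ∈ {i | i ≠ v₁ ∧ i ≠ v₁.succAbove v₂''} :=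
    ⟨Fin.succAbove_ne v₁ _, fun e => Fin.succAbove_ne v₂'' k' (Fin.succAbove_right_injective e)⟩
  exact Fin.succAbove_right_injective (Fin.succAbove_right_injective (hinj hk hk' he))

/-! ## 2. The double-core engine -/

/-- The «no double step on the row side» clause, as handed to the core prover (`u` = rows,
`w` = columns; swap the arguments for the column side). -/
theorem doubleStep_of_data {h r R : ℕ}
    (ih : ∀ (h r : ℕ), r ≤ R → ∀ (u w : Fin r → Finset (Fin h)), Function.Injective u →
      Function.Injective w →
      ∃ ℓ : Fin (h + h) → MvPolynomial (Fin (h + h)) ℂ, (∀ q, (ℓ q).totalDegree ≤ 1) ∧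
        (Matrix.of fun i j : Fin r => coeff
          (∑ b ∈ u i, Finsupp.single (Fin.castAdd h b) 1 + ∑ d ∈ w j, Finsupp.single (Fin.natAdd h d) 1)
          (∏ q, ℓ q)).det ≠ 0)
    (u w : Fin r → Finset (Fin h)) (hrR : r ≤ R + 2) (a a' c c' : Fin h)
    (i₀ v₁ v₂ j₀ j₀' j₁ j₂ : Fin r) (haa : a' ≠ a) (hcc : c' ≠ c) (hi₁ : v₁ ≠ i₀) (hi₂ : v₂ ≠ i₀)
    (h12 : v₂ ≠ v₁)
    (ha₁ : a ∈ u v₁ ↔ a ∉ u i₀) (ha'₁ : a' ∈ u v₁ ↔ a' ∈ u i₀) (ha₂ : a ∈ u v₂ ↔ a ∈ u i₀)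
    (ha'₂ : a' ∈ u v₂ ↔ a' ∉ u i₀)
    (hlab₁ : ((u v₁).erase a).erase a' = ((u i₀).erase a).erase a')
    (hlab₂ : ((u v₂).erase a).erase a' = ((u i₀).erase a).erase a')
    (hj₀ : j₀ ≠ j₁) (hj₀' : j₀' ≠ j₁) (hj₀'₂ : j₀' ≠ j₂) (hj12 : j₂ ≠ j₁)
    (hcol₁ : ((w j₁).erase c).erase c' = ((w j₀).erase c).erase c')
    (hcol₂ : ((w j₂).erase c).erase c' = ((w j₀').erase c).erase c')
    (hδ : ((if c ∈ w j₁ then (1 : ℂ) else 0) - (if c ∈ w j₀ then 1 else 0)) *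
        ((if c' ∈ w j₂ then (1 : ℂ) else 0) - (if c' ∈ w j₀' then 1 else 0)) ≠
      ((if c ∈ w j₂ then (1 : ℂ) else 0) - (if c ∈ w j₀' then 1 else 0)) *
        ((if c' ∈ w j₁ then (1 : ℂ) else 0) - (if c' ∈ w j₀ then 1 else 0)))
    (hinju : Set.InjOn (fun i => ((u i).erase a).erase a') {i | i ≠ v₁ ∧ i ≠ v₂})
    (hinjw : Set.InjOn (fun j => ((w j).erase c).erase c') {j | j ≠ j₁ ∧ j ≠ j₂}) :
    ∃ ℓ : Fin (h + h) → MvPolynomial (Fin (h + h)) ℂ, (∀ q, (ℓ q).totalDegree ≤ 1) ∧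
      (Matrix.of fun i j : Fin r => coeff
        (∑ b ∈ u i, Finsupp.single (Fin.castAdd h b) 1 + ∑ d ∈ w j, Finsupp.single (Fin.natAdd h d) 1)
        (∏ q, ℓ q)).det ≠ 0 := by
  classical
  -- two distinct coordinates and two distinct rows force `h, r ≥ 2`
  obtain ⟨h'', rfl⟩ : ∃ h'', h = h'' + 2 := ⟨h - 2, by
    have h1 := a.isLt; have h2 := a'.isLt; have h3 : (a : ℕ) ≠ a' := fun e => haa (Fin.ext e).symm
    omega⟩
  obtain ⟨r'', rfl⟩ : ∃ r'', r = r'' + 2 := ⟨r - 2, by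
    have h1 := v₁.isLt; have h2 := i₀.isLt; have h3 : (v₁ : ℕ) ≠ i₀ := fun e => hi₁ (Fin.ext e)
    omega⟩
  obtain ⟨a'', rfl⟩ := Fin.exists_succAbove_eq haa
  obtain ⟨c'', rfl⟩ := Fin.exists_succAbove_eq hcc
  obtain ⟨v₂'', rfl⟩ := Fin.exists_succAbove_eq h12
  obtain ⟨j₂'', rfl⟩ := Fin.exists_succAbove_eq hj12
  exact chow_doubleStep a c a'' c'' u w i₀ v₁ v₂'' j₀ j₀' j₁ j₂'' hi₁ hi₂ ha₁ ha'₁ ha₂ ha'₂ hlab₁ hlab₂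
    hj₀ hj₀' hj₀'₂ hcol₁ hcol₂ hδ
    (ih h'' r'' (by omega) _ _ (preimage₂_injective_of_injOn a a'' u v₁ v₂'' hinju)
      (preimage₂_injective_of_injOn c c'' w j₁ j₂'' hinjw))

/-- **DOUBLE-CORE ENGINE (bounded form).**  If every injective layout that is locked, unpeelable, of
size `r ≥ h + 1` and admits no leaf step, no edge step and no double step on either side is hit, then
every injective layout of size `r ≤ R` is hit. -/
theorem chow_hit_of_doubleCore_le
    (core : ∀ (h r : ℕ) (u w : Fin r → Finset (Fin h)), Function.Injective u → Function.Injective w →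
      (∀ (a c : Fin h) (β γ : Bool),
        (Finset.univ.filter fun i => (a ∈ u i ↔ β = true)).card ≠
          (Finset.univ.filter fun j => (c ∈ w j ↔ γ = true)).card) →
      (∀ a c : Fin h, ¬ (Function.Injective (fun i => (u i).erase a) ∧
        Function.Injective (fun j => (w j).erase c))) →
      h + 1 ≤ r →
      (∀ (a c : Fin h) (i₁ j₁ j₀ : Fin r), (∀ i, i ≠ i₁ → (a ∈ u i ↔ a ∉ u i₁)) → j₁ ≠ j₀ →
        w j₀ = (w j₁).erase c → ¬ Set.InjOn (fun j => (w j).erase c) {j | j ≠ j₁}) →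
      (∀ (c a : Fin h) (j₁ i₁ i₀ : Fin r), (∀ j, j ≠ j₁ → (c ∈ w j ↔ c ∉ w j₁)) → i₁ ≠ i₀ →
        u i₀ = (u i₁).erase a → ¬ Set.InjOn (fun i => (u i).erase a) {i | i ≠ i₁}) →
      (∀ (a c : Fin h) (i₁ i₀ j₁ j₀ : Fin r), i₁ ≠ i₀ → u i₀ = (u i₁).erase a → j₁ ≠ j₀ →
        w j₀ = (w j₁).erase c → ¬ (Set.InjOn (fun i => (u i).erase a) {i | i ≠ i₁} ∧
          Set.InjOn (fun j => (w j).erase c) {j | j ≠ j₁})) →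
      (∀ (a a' c c' : Fin h) (i₀ v₁ v₂ j₀ j₀' j₁ j₂ : Fin r), a' ≠ a → c' ≠ c → v₁ ≠ i₀ → v₂ ≠ i₀ →
        v₂ ≠ v₁ → (a ∈ u v₁ ↔ a ∉ u i₀) → (a' ∈ u v₁ ↔ a' ∈ u i₀) → (a ∈ u v₂ ↔ a ∈ u i₀) →
        (a' ∈ u v₂ ↔ a' ∉ u i₀) → ((u v₁).erase a).erase a' = ((u i₀).erase a).erase a' →
        ((u v₂).erase a).erase a' = ((u i₀).erase a).erase a' →
        j₀ ≠ j₁ → j₀' ≠ j₁ → j₀' ≠ j₂ → j₂ ≠ j₁ →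
        ((w j₁).erase c).erase c' = ((w j₀).erase c).erase c' →
        ((w j₂).erase c).erase c' = ((w j₀').erase c).erase c' →
        ((if c ∈ w j₁ then (1 : ℂ) else 0) - (if c ∈ w j₀ then 1 else 0)) *
            ((if c' ∈ w j₂ then (1 : ℂ) else 0) - (if c' ∈ w j₀' then 1 else 0)) ≠
          ((if c ∈ w j₂ then (1 : ℂ) else 0) - (if c ∈ w j₀' then 1 else 0)) *
            ((if c' ∈ w j₁ then (1 : ℂ) else 0) - (if c' ∈ w j₀ then 1 else 0)) →
        ¬ (Set.InjOn (fun i => ((u i).erase a).erase a') {i | i ≠ v₁ ∧ i ≠ v₂} ∧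
          Set.InjOn (fun j => ((w j).erase c).erase c') {j | j ≠ j₁ ∧ j ≠ j₂})) →
      (∀ (c c' a a' : Fin h) (j₀ v₁ v₂ i₀ i₀' i₁ i₂ : Fin r), c' ≠ c → a' ≠ a → v₁ ≠ j₀ → v₂ ≠ j₀ →
        v₂ ≠ v₁ → (c ∈ w v₁ ↔ c ∉ w j₀) → (c' ∈ w v₁ ↔ c' ∈ w j₀) → (c ∈ w v₂ ↔ c ∈ w j₀) →
        (c' ∈ w v₂ ↔ c' ∉ w j₀) → ((w v₁).erase c).erase c' = ((w j₀).erase c).erase c' →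
        ((w v₂).erase c).erase c' = ((w j₀).erase c).erase c' →
        i₀ ≠ i₁ → i₀' ≠ i₁ → i₀' ≠ i₂ → i₂ ≠ i₁ →
        ((u i₁).erase a).erase a' = ((u i₀).erase a).erase a' →
        ((u i₂).erase a).erase a' = ((u i₀').erase a).erase a' →
        ((if a ∈ u i₁ then (1 : ℂ) else 0) - (if a ∈ u i₀ then 1 else 0)) *
            ((if a' ∈ u i₂ then (1 : ℂ) else 0) - (if a' ∈ u i₀' then 1 else 0)) ≠
          ((if a ∈ u i₂ then (1 : ℂ) else 0) - (if a ∈ u i₀' then 1 else 0)) *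
            ((if a' ∈ u i₁ then (1 : ℂ) else 0) - (if a' ∈ u i₀ then 1 else 0)) →
        ¬ (Set.InjOn (fun j => ((w j).erase c).erase c') {j | j ≠ v₁ ∧ j ≠ v₂} ∧
          Set.InjOn (fun i => ((u i).erase a).erase a') {i | i ≠ i₁ ∧ i ≠ i₂})) →
      ∃ ℓ : Fin (h + h) → MvPolynomial (Fin (h + h)) ℂ, (∀ q, (ℓ q).totalDegree ≤ 1) ∧
        (Matrix.of fun i j : Fin r => coeff
          (∑ b ∈ u i, Finsupp.single (Fin.castAdd h b) 1 + ∑ d ∈ w j, Finsupp.single (Fin.natAdd h d) 1)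
          (∏ q, ℓ q)).det ≠ 0)
    (R : ℕ) : ∀ (h r : ℕ), r ≤ R → ∀ (u w : Fin r → Finset (Fin h)), Function.Injective u →
      Function.Injective w →
      ∃ ℓ : Fin (h + h) → MvPolynomial (Fin (h + h)) ℂ, (∀ q, (ℓ q).totalDegree ≤ 1) ∧
        (Matrix.of fun i j : Fin r => coeff
          (∑ b ∈ u i, Finsupp.single (Fin.castAdd h b) 1 + ∑ d ∈ w j, Finsupp.single (Fin.natAdd h d) 1)
          (∏ q, ℓ q)).det ≠ 0 := by
  classical
  induction R with
  | zero =>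
    intro h r hr u w hu hw
    exact chowHits_of_size_le_three h r (by omega) u w hu hw
  | succ R ih =>
    intro h r hr u w hu hw
    refine chow_hit_of_core_le (R + 1) ?_ h r hr u w hu hw
    intro h' r' u' w' hr' hu' hw' hlk hpl hsz
    -- edge step
    by_cases hedge : ∃ (a c : Fin h') (i₁ i₀ j₁ j₀ : Fin r'), i₁ ≠ i₀ ∧ u' i₀ = (u' i₁).erase a ∧
        j₁ ≠ j₀ ∧ w' j₀ = (w' j₁).erase c ∧ Set.InjOn (fun i => (u' i).erase a) {i | i ≠ i₁} ∧
        Set.InjOn (fun j => (w' j).erase c) {j | j ≠ j₁}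
    · obtain ⟨a, c, i₁, i₀, j₁, j₀, hi, hi₀, hj, hj₀, hinju, hinjw⟩ := hedge
      obtain ⟨h'', rfl⟩ : ∃ h'', h' = h'' + 1 := ⟨h' - 1, by have := a.pos; omega⟩
      obtain ⟨r'', rfl⟩ : ∃ r'', r' = r'' + 1 := ⟨r' - 1, by have := i₁.pos; omega⟩
      exact chow_edgeStep a c u' w' i₁ i₀ j₁ j₀ hi (mem_of_edge u' hu' hi hi₀) hi₀ hj
        (mem_of_edge w' hw' hj hj₀) hj₀
        (ih h'' r'' (by omega) _ _ (preimage_succAbove_injective_of_injOn a u' i₁ hinju)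
          (preimage_succAbove_injective_of_injOn c w' j₁ hinjw))
    -- leaf steps
    by_cases hrow : ∃ (a c : Fin h') (i₁ j₁ j₀ : Fin r'), (∀ i, i ≠ i₁ → (a ∈ u' i ↔ a ∉ u' i₁)) ∧
        j₁ ≠ j₀ ∧ w' j₀ = (w' j₁).erase c ∧ Set.InjOn (fun j => (w' j).erase c) {j | j ≠ j₁}
    · obtain ⟨a, c, i₁, j₁, j₀, hlone, hj, hj₀, hinj⟩ := hrow
      obtain ⟨h'', rfl⟩ : ∃ h'', h' = h'' + 1 := ⟨h' - 1, by have := a.pos; omega⟩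
      obtain ⟨r'', rfl⟩ : ∃ r'', r' = r'' + 1 := ⟨r' - 1, by have := i₁.pos; omega⟩
      exact chow_leafStep a c u' w' i₁ j₁ j₀ hlone hj (mem_of_edge w' hw' hj hj₀) hj₀
        (ih h'' r'' (by omega) _ _ (preimage_succAbove_injective_of_lonely a u' hu' i₁ hlone)
          (preimage_succAbove_injective_of_injOn c w' j₁ hinj))
    by_cases hcol : ∃ (c a : Fin h') (j₁ i₁ i₀ : Fin r'), (∀ j, j ≠ j₁ → (c ∈ w' j ↔ c ∉ w' j₁)) ∧
        i₁ ≠ i₀ ∧ u' i₀ = (u' i₁).erase a ∧ Set.InjOn (fun i => (u' i).erase a) {i | i ≠ i₁}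
    · obtain ⟨c, a, j₁, i₁, i₀, hlone, hi, hi₀, hinj⟩ := hcol
      obtain ⟨h'', rfl⟩ : ∃ h'', h' = h'' + 1 := ⟨h' - 1, by have := a.pos; omega⟩
      obtain ⟨r'', rfl⟩ : ∃ r'', r' = r'' + 1 := ⟨r' - 1, by have := i₁.pos; omega⟩
      refine chow_hit_swap u' w' ?_
      exact chow_leafStep c a w' u' j₁ i₁ i₀ hlone hi (mem_of_edge u' hu' hi hi₀) hi₀
        (ih h'' r'' (by omega) _ _ (preimage_succAbove_injective_of_lonely c w' hw' j₁ hlone)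
          (preimage_succAbove_injective_of_injOn a u' i₁ hinj))
    -- double steps
    by_cases hd : ∃ (a a' c c' : Fin h') (i₀ v₁ v₂ j₀ j₀' j₁ j₂ : Fin r'), a' ≠ a ∧ c' ≠ c ∧ v₁ ≠ i₀ ∧
        v₂ ≠ i₀ ∧ v₂ ≠ v₁ ∧ (a ∈ u' v₁ ↔ a ∉ u' i₀) ∧ (a' ∈ u' v₁ ↔ a' ∈ u' i₀) ∧
        (a ∈ u' v₂ ↔ a ∈ u' i₀) ∧ (a' ∈ u' v₂ ↔ a' ∉ u' i₀) ∧
        ((u' v₁).erase a).erase a' = ((u' i₀).erase a).erase a' ∧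
        ((u' v₂).erase a).erase a' = ((u' i₀).erase a).erase a' ∧
        j₀ ≠ j₁ ∧ j₀' ≠ j₁ ∧ j₀' ≠ j₂ ∧ j₂ ≠ j₁ ∧
        ((w' j₁).erase c).erase c' = ((w' j₀).erase c).erase c' ∧
        ((w' j₂).erase c).erase c' = ((w' j₀').erase c).erase c' ∧
        ((if c ∈ w' j₁ then (1 : ℂ) else 0) - (if c ∈ w' j₀ then 1 else 0)) *
            ((if c' ∈ w' j₂ then (1 : ℂ) else 0) - (if c' ∈ w' j₀' then 1 else 0)) ≠
          ((if c ∈ w' j₂ then (1 : ℂ) else 0) - (if c ∈ w' j₀' then 1 else 0)) *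
            ((if c' ∈ w' j₁ then (1 : ℂ) else 0) - (if c' ∈ w' j₀ then 1 else 0)) ∧
        Set.InjOn (fun i => ((u' i).erase a).erase a') {i | i ≠ v₁ ∧ i ≠ v₂} ∧
        Set.InjOn (fun j => ((w' j).erase c).erase c') {j | j ≠ j₁ ∧ j ≠ j₂}
    · obtain ⟨a, a', c, c', i₀, v₁, v₂, j₀, j₀', j₁, j₂, haa, hcc, hi₁, hi₂, h12, ha₁, ha'₁, ha₂, ha'₂,
        hlab₁, hlab₂, hj₀, hj₀', hj₀'₂, hj12, hcol₁, hcol₂, hδ, hinju, hinjw⟩ := hd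
      exact doubleStep_of_data ih u' w' (by omega) a a' c c' i₀ v₁ v₂ j₀ j₀' j₁ j₂ haa hcc hi₁ hi₂ h12
        ha₁ ha'₁ ha₂ ha'₂ hlab₁ hlab₂ hj₀ hj₀' hj₀'₂ hj12 hcol₁ hcol₂ hδ hinju hinjw
    by_cases hd' : ∃ (c c' a a' : Fin h') (j₀ v₁ v₂ i₀ i₀' i₁ i₂ : Fin r'), c' ≠ c ∧ a' ≠ a ∧ v₁ ≠ j₀ ∧
        v₂ ≠ j₀ ∧ v₂ ≠ v₁ ∧ (c ∈ w' v₁ ↔ c ∉ w' j₀) ∧ (c' ∈ w' v₁ ↔ c' ∈ w' j₀) ∧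
        (c ∈ w' v₂ ↔ c ∈ w' j₀) ∧ (c' ∈ w' v₂ ↔ c' ∉ w' j₀) ∧
        ((w' v₁).erase c).erase c' = ((w' j₀).erase c).erase c' ∧
        ((w' v₂).erase c).erase c' = ((w' j₀).erase c).erase c' ∧
        i₀ ≠ i₁ ∧ i₀' ≠ i₁ ∧ i₀' ≠ i₂ ∧ i₂ ≠ i₁ ∧
        ((u' i₁).erase a).erase a' = ((u' i₀).erase a).erase a' ∧
        ((u' i₂).erase a).erase a' = ((u' i₀').erase a).erase a' ∧
        ((if a ∈ u' i₁ then (1 : ℂ) else 0) - (if a ∈ u' i₀ then 1 else 0)) *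
            ((if a' ∈ u' i₂ then (1 : ℂ) else 0) - (if a' ∈ u' i₀' then 1 else 0)) ≠
          ((if a ∈ u' i₂ then (1 : ℂ) else 0) - (if a ∈ u' i₀' then 1 else 0)) *
            ((if a' ∈ u' i₁ then (1 : ℂ) else 0) - (if a' ∈ u' i₀ then 1 else 0)) ∧
        Set.InjOn (fun j => ((w' j).erase c).erase c') {j | j ≠ v₁ ∧ j ≠ v₂} ∧
        Set.InjOn (fun i => ((u' i).erase a).erase a') {i | i ≠ i₁ ∧ i ≠ i₂}
    · obtain ⟨c, c', a, a', j₀, v₁, v₂, i₀, i₀', i₁, i₂, hcc, haa, hi₁, hi₂, h12, ha₁, ha'₁, ha₂, ha'₂,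
        hlab₁, hlab₂, hj₀, hj₀', hj₀'₂, hj12, hcol₁, hcol₂, hδ, hinjw, hinju⟩ := hd'
      refine chow_hit_swap u' w' ?_
      exact doubleStep_of_data ih w' u' (by omega) c c' a a' j₀ v₁ v₂ i₀ i₀' i₁ i₂ hcc haa hi₁ hi₂ h12
        ha₁ ha'₁ ha₂ ha'₂ hlab₁ hlab₂ hj₀ hj₀' hj₀'₂ hj12 hcol₁ hcol₂ hδ hinjw hinju
    -- no step available: a double-core
    push Not at hedge hrow hcol hd hd'
    exact core h' r' u' w' hu' hw' hlk hpl hsz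
      (fun a c i₁ j₁ j₀ hlone hj hj₀ => hrow a c i₁ j₁ j₀ hlone hj hj₀)
      (fun c a j₁ i₁ i₀ hlone hi hi₀ => hcol c a j₁ i₁ i₀ hlone hi hi₀)
      (fun a c i₁ i₀ j₁ j₀ hi hi₀ hj hj₀ hboth => hedge a c i₁ i₀ j₁ j₀ hi hi₀ hj hj₀ hboth.1 hboth.2)
      (fun a a' c c' i₀ v₁ v₂ j₀ j₀' j₁ j₂ h1 h2 h3 h4 h5 h6 h7 h8 h9 h10 h11 h12 h13 h14 h15 h16 h17 h18
          hboth => hd a a' c c' i₀ v₁ v₂ j₀ j₀' j₁ j₂ h1 h2 h3 h4 h5 h6 h7 h8 h9 h10 h11 h12 h13 h14 h15 h16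
          h17 h18 hboth.1 hboth.2)
      (fun c c' a a' j₀ v₁ v₂ i₀ i₀' i₁ i₂ h1 h2 h3 h4 h5 h6 h7 h8 h9 h10 h11 h12 h13 h14 h15 h16 h17 h18
          hboth => hd' c c' a a' j₀ v₁ v₂ i₀ i₀' i₁ i₂ h1 h2 h3 h4 h5 h6 h7 h8 h9 h10 h11 h12 h13 h14 h15
          h16 h17 h18 hboth.1 hboth.2)

/-- **DOUBLE-CORE ENGINE.**  If every injective layout that is locked, unpeelable, of size
`r ≥ h + 1`, admits no leaf step, no edge step and no double step on either side is hit by a product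
of `h + h` affine forms, then every injective layout is hit. -/
theorem chow_hit_of_doubleCore
    (core : ∀ (h r : ℕ) (u w : Fin r → Finset (Fin h)), Function.Injective u → Function.Injective w →
      (∀ (a c : Fin h) (β γ : Bool),
        (Finset.univ.filter fun i => (a ∈ u i ↔ β = true)).card ≠
          (Finset.univ.filter fun j => (c ∈ w j ↔ γ = true)).card) →
      (∀ a c : Fin h, ¬ (Function.Injective (fun i => (u i).erase a) ∧
        Function.Injective (fun j => (w j).erase c))) →
      h + 1 ≤ r →
      (∀ (a c : Fin h) (i₁ j₁ j₀ : Fin r), (∀ i, i ≠ i₁ → (a ∈ u i ↔ a ∉ u i₁)) → j₁ ≠ j₀ →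
        w j₀ = (w j₁).erase c → ¬ Set.InjOn (fun j => (w j).erase c) {j | j ≠ j₁}) →
      (∀ (c a : Fin h) (j₁ i₁ i₀ : Fin r), (∀ j, j ≠ j₁ → (c ∈ w j ↔ c ∉ w j₁)) → i₁ ≠ i₀ →
        u i₀ = (u i₁).erase a → ¬ Set.InjOn (fun i => (u i).erase a) {i | i ≠ i₁}) →
      (∀ (a c : Fin h) (i₁ i₀ j₁ j₀ : Fin r), i₁ ≠ i₀ → u i₀ = (u i₁).erase a → j₁ ≠ j₀ →
        w j₀ = (w j₁).erase c → ¬ (Set.InjOn (fun i => (u i).erase a) {i | i ≠ i₁} ∧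
          Set.InjOn (fun j => (w j).erase c) {j | j ≠ j₁})) →
      (∀ (a a' c c' : Fin h) (i₀ v₁ v₂ j₀ j₀' j₁ j₂ : Fin r), a' ≠ a → c' ≠ c → v₁ ≠ i₀ → v₂ ≠ i₀ →
        v₂ ≠ v₁ → (a ∈ u v₁ ↔ a ∉ u i₀) → (a' ∈ u v₁ ↔ a' ∈ u i₀) → (a ∈ u v₂ ↔ a ∈ u i₀) →
        (a' ∈ u v₂ ↔ a' ∉ u i₀) → ((u v₁).erase a).erase a' = ((u i₀).erase a).erase a' →
        ((u v₂).erase a).erase a' = ((u i₀).erase a).erase a' →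
        j₀ ≠ j₁ → j₀' ≠ j₁ → j₀' ≠ j₂ → j₂ ≠ j₁ →
        ((w j₁).erase c).erase c' = ((w j₀).erase c).erase c' →
        ((w j₂).erase c).erase c' = ((w j₀').erase c).erase c' →
        ((if c ∈ w j₁ then (1 : ℂ) else 0) - (if c ∈ w j₀ then 1 else 0)) *
            ((if c' ∈ w j₂ then (1 : ℂ) else 0) - (if c' ∈ w j₀' then 1 else 0)) ≠
          ((if c ∈ w j₂ then (1 : ℂ) else 0) - (if c ∈ w j₀' then 1 else 0)) *
            ((if c' ∈ w j₁ then (1 : ℂ) else 0) - (if c' ∈ w j₀ then 1 else 0)) →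
        ¬ (Set.InjOn (fun i => ((u i).erase a).erase a') {i | i ≠ v₁ ∧ i ≠ v₂} ∧
          Set.InjOn (fun j => ((w j).erase c).erase c') {j | j ≠ j₁ ∧ j ≠ j₂})) →
      (∀ (c c' a a' : Fin h) (j₀ v₁ v₂ i₀ i₀' i₁ i₂ : Fin r), c' ≠ c → a' ≠ a → v₁ ≠ j₀ → v₂ ≠ j₀ →
        v₂ ≠ v₁ → (c ∈ w v₁ ↔ c ∉ w j₀) → (c' ∈ w v₁ ↔ c' ∈ w j₀) → (c ∈ w v₂ ↔ c ∈ w j₀) →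
        (c' ∈ w v₂ ↔ c' ∉ w j₀) → ((w v₁).erase c).erase c' = ((w j₀).erase c).erase c' →
        ((w v₂).erase c).erase c' = ((w j₀).erase c).erase c' →
        i₀ ≠ i₁ → i₀' ≠ i₁ → i₀' ≠ i₂ → i₂ ≠ i₁ →
        ((u i₁).erase a).erase a' = ((u i₀).erase a).erase a' →
        ((u i₂).erase a).erase a' = ((u i₀').erase a).erase a' →
        ((if a ∈ u i₁ then (1 : ℂ) else 0) - (if a ∈ u i₀ then 1 else 0)) *
            ((if a' ∈ u i₂ then (1 : ℂ) else 0) - (if a' ∈ u i₀' then 1 else 0)) ≠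
          ((if a ∈ u i₂ then (1 : ℂ) else 0) - (if a ∈ u i₀' then 1 else 0)) *
            ((if a' ∈ u i₁ then (1 : ℂ) else 0) - (if a' ∈ u i₀ then 1 else 0)) →
        ¬ (Set.InjOn (fun j => ((w j).erase c).erase c') {j | j ≠ v₁ ∧ j ≠ v₂} ∧
          Set.InjOn (fun i => ((u i).erase a).erase a') {i | i ≠ i₁ ∧ i ≠ i₂})) →
      ∃ ℓ : Fin (h + h) → MvPolynomial (Fin (h + h)) ℂ, (∀ q, (ℓ q).totalDegree ≤ 1) ∧
        (Matrix.of fun i j : Fin r => coeff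
          (∑ b ∈ u i, Finsupp.single (Fin.castAdd h b) 1 + ∑ d ∈ w j, Finsupp.single (Fin.natAdd h d) 1)
          (∏ q, ℓ q)).det ≠ 0)
    (h r : ℕ) (u w : Fin r → Finset (Fin h)) (hu : Function.Injective u)
    (hw : Function.Injective w) :
    ∃ ℓ : Fin (h + h) → MvPolynomial (Fin (h + h)) ℂ, (∀ q, (ℓ q).totalDegree ≤ 1) ∧
      (Matrix.of fun i j : Fin r => coeff
        (∑ b ∈ u i, Finsupp.single (Fin.castAdd h b) 1 + ∑ d ∈ w j, Finsupp.single (Fin.natAdd h d) 1)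
        (∏ q, ℓ q)).det ≠ 0 :=
  chow_hit_of_doubleCore_le core r h r le_rfl u w hu hw

end

end Summit.ValiantsHypothesis.ValiantsHypothesis.Theorems.BarrierLever.ChowFactor
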